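import Literature.MathematicalPhysics.QuantumFieldTheory.Balaban1983to89.T4InsertionProfile

/-!
# T4JointInsertionProfile — row T4-U5.E-a2-JOINT° (T4-DAG v8 §5/§6, node U5 / NE7b, clause E2-ent): the JOINT
insertion-profile count — (A) ACROSS all simultaneously pending slots the joint profile is a PRODUCT (the only loss is
`∏ (1 + x_i) − 1 ≤ e^{Σ x_i} − 1`, already the slot budget's), and (B) WITHIN one slot the COMPOSITE count over a
structure's whole pending life (events × pieces × volumes × attachment sites) is of the doubly graded type `Γ^k · C^w`
of `T4InsertionProfile.gradedShapeSum_le`, the attachment entropy of later events being exponential in the TOTAL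
volume by the geometric SHRINKING of old regions (`∏_e N_e ≤ κ^{#E} · exp(μθ/(1−θ) · Σ_b w_b)`), and the
window-position entropy per event being paid scale-locally by that event's own credit — so the composite constants are
CUTOFF-INDEPENDENT once the located inputs are (cell `pub-balaban`, estimate cell EST; pure cell arithmetic: typed
hypothesis shapes + kernel bookkeeping; NO printed claim, nothing of Bałaban's asserted)

HONEST FRAMING (cell `pub-balaban`, T4-DAG PAGE 1).  The cell's T4 target is the existence AND uniqueness of the
continuum limit of Bałaban's unit-scale averaged loop expectations on a FIXED finite torus — strictly beyond ultraviolet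
stability ([Balaban1989LargeFieldII] Thm 1 p. 355); it is NOT the Yang–Mills mass gap and NOT the Clay problem.  This
module serves ONE clause of the cell's own uniqueness spine: the counting clause (ENT) of `T4InsertionProfile.PointDom`
(node U5c, weight bound NE7b in the pointwise form), at the two places where a "joint" count could lose more than the
per-slot / per-event counts provide.  Nothing of Bałaban's is asserted: every «…» below was READ BY THIS SEAT ON THE
RENDERED JOURNAL PAGE (PNG ×2) and is quoted for CONTEXT, SHAPE AND LOCATION ONLY; the hypothesis shapes of §2–§4 (a
site-count bound of shrinking type, a multiplicity bound, a record count, a credit/window pairing) are consumed only as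
binders and are flagged NOT PRINTED.  Value = typed located hypothesis shapes + kernel bookkeeping, NOT an estimate of
Bałaban's expansion, NOT summit progress.

CITATION HEADER.
* [Balaban1989LargeFieldII] = T. Bałaban, *Large field renormalization. II. Localization, exponentiation, and bounds for
  the ℝ operation*, Commun. Math. Phys. **122** (1989) 355–392 (cell paper B16; PDF page = journal page − 354; renders
  `b2b-balaban-ref1/pages/1989-cmp122-large-field-II/1989-cmp122-large-field-II-pNNN-x2.png`, NNN = 029 (p. 383) and
  030 (p. 384), both read by this seat this generation as images).
  p. 384 [p030], THE OPERATION S (where a later event attaches to an old region): «If Z is a union of MR_j-cubes of the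
  lattice T_ξ, ξ = L^{−j}, then we take the cover Z′ of Z by a smallest union of LMR_{j+1}-cubes, and we add ten layers of
  such cubes. We denote the obtained domain by S(Z), i.e., S(Z) = Z′^{∼10}. Such a domain arises as a new large field
  region in our procedure, if no large fields are created in a neighborhood of Z, more precisely in S(Z)\Z. The operation
  S may be iterated.»;  THE RENEWAL CLOCK: «The factor exp(−κ_j(Z)) controls K renormalization steps, under the
  assumption that no large fields are created in these steps, where the number K is the smallest positive integer having
  the property that the domain S^K(Z), considered as a domain in the lattice of the scale L^{−(j+K)}, satisfies the
  conditions (i), (ii), with N = R_j.»;  SIZE OF THE NEIGHBOURHOOD AND SHRINKING: «Denote by Z^{(n−j)} the cover of Z by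
  MR_n-cubes in the corresponding scale (i.e., by L^{n−j}MR_n-cubes in L^{−j}-scale). Thus S^{n−j}(Z) ⊂ ∪_{□₀ ⊂ Z^{(n−j)}}
  □₀^{∼31}, and this implies d′_n(S^{n−j}(Z)) ≤ (63)^d(MR_n)^{−d}|Z^{(n−j)}| ≤ (63)^d 3·2^{d−1}d′_n(Z^{(n−j)}) if the
  linear size on the right-hand side is different from 0, or d′_n(S^{n−j}(Z)) ≤ (64)^d if it is equal to 0. From the
  scaling property (6.31) [I] we obtain d′_n(Z^{(n−j)}) ≤ L^{−1/2(n−j)}d′_j(Z) ≤ 2^{−(n−j)}d′_j(Z)».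
  READING (the cell's, NOT a quotation): the neighbourhood in which a later event can touch an old region is governed by
  the region's cover AT THE CURRENT SCALE, whose size is a constant plus a geometrically SHRUNK multiple of the birth
  size — the TYPE `N_e ≤ κ · (1 + Σ_b w_b · θ^{t_e − t_b})`, `0 ≤ θ < 1`, of the site-count hypothesis of §2.  p. 383
  [p029], THE COUNTING FACTOR: «Finally, the summations over the admissible sequences can be replaced by the factors
  exp O(1)(MR_j)^{−d}|Z_j|.» — the printed TYPE "exponential in the volume" of every count here (the surrounding
  passage and (1.79) are quoted in full in `T4InsertionProfile`).
  WHAT THESE PAGES DO NOT PRINT (and this module does NOT assert): any count of insertion profiles / composite shapes of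
  a pending structure inside a frozen history, jointly over its events or jointly over slots; the site-count bound as a
  bound on attachment sites of renewals and mergers; the multiplicity `μ` (events touching one piece per step); the
  identification of `κ, θ, μ, Γ₀, C` with Bałaban's `(63)^d 3·2^{d−1}`, `2^{−1}`, `R_j`, ….  These are hypothesis SHAPES
  of the cell's clause E2-ent (record t4/T4-EST-U5Ea2.md §3), located here and consumed only as binders.

THE POINT.  `T4InsertionProfile.gradedShapeSum_le` takes the joint count `#{s : m s = k, v s = w} ≤ Γ^k · C^w` of ONE
slot's shapes as the hypothesis `hcount`, with the docstring remark that the attachment entropy of later events is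
"absorbed in C^w — cell reading, NOT kernel-proved"; and `T4HistoryPeeling.SwitchOff.fibre_dom` bounds a fibre with
charge `Q` by `∏_{i ∈ Q} x i`.  Row T4-U5.E-a2-JOINT° asks whether counting JOINTLY — over all pending slots at once, and
over all events of one structure at once — costs an uncounted combinatorial factor, possibly growing with the cutoff
(«L^{4·A(K)}», A(K) = the LOG-window length).  The kernel answers:
§1 ACROSS SLOTS the joint profile over a charge `Q` is the dependent product `Q.pi Sh` of the per-slot catalogues
(`card_jointCatalogue`: cardinality `∏_{i∈Q} #Sh i`; `jointEntropy_eq_prod`: the joint price sum is the product of the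
slot entropies, hence `≤ ∏_{i∈Q} x i`, `jointEntropy_le`), and summing over all charges gives EXACTLY
`Σ_Q ∏_{i∈Q} x i = ∏_i (1 + x i) ≤ exp(Σ_i x i)` (`jointActivity_eq`, `jointActivity_le_exp`) — for a `PointDom` this is
the per-`(K,t)` statement `Σ_{bad} A ≤ (∏_i (1 + x i) − 1) · Σ_{good} A` (`PointDom.jointFibre`, =
`T4PeierlsDomination.sum_le_of_fibre_dom` ∘ `fibre_dom`).  The window multiplicity lives ONLY in the slot budget
`Σ_i x i ≤ S K` (`T4HistoryPeeling.slotBudget_le`, `T4GoodClassBudget.summable_polyRate_logWindow`); no factor A(K)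
multiplies the per-slot counts.
§2 WITHIN ONE SLOT, THE SHRINKING ATTACHMENT ENTROPY (the analytic heart, typed): pieces `b ∈ B` (regions of the
structure) with volumes `w_b ≥ 0` and birth times `t_b`, events `e ∈ E` (renewals, mergers, later creations) with times
`t_e` and piece sets `P_e ⊆ B` of STRICTLY OLDER pieces, at most `μ` events touching a given piece per time, and site
factors `0 ≤ N_e ≤ κ · (1 + Σ_{b ∈ P_e} w_b θ^{t_e − t_b})`, `0 ≤ θ < 1` ⇒ `∏_{e ∈ E} N_e ≤ κ^{#E} · exp(μθ/(1−θ) · Σ_b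
w_b)` (`prod_sites_le_exp`; kernel: `x ≤ … ⇒ ∏ κ(1+x_e) ≤ κ^{#E} e^{Σ x_e}`, the double sum swapped onto pieces
`siteExponent_le`, per piece a geometric series over the distinct later times `eventSum_le` / `sum_pow_sub_le`).  A
constant PER EVENT and an exponential in the TOTAL VOLUME — never a power of the volume per event (which a non-shrinking
site count `N_e ~ Σ w_b` would give: `∏_e N_e ~ w^{#E}`, not of type `Γ^k C^w`), and never a power `Λ^{t_e − t_b}` (which
counting sites in the FINAL lattice would give).
§3 THE COMPOSITE (events × pieces × volumes × sites) ENTROPY OF ONE SLOT in the weighted form that feeds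
`T4HistoryPeeling.recordSum_le` directly: for one record with `k` events and `p ≥ 1` pieces, volume vectors
`f ∈ Wv^p` (`Wv ⊆ ℕ_{≥1}`), site products `N f ≤ κ^k e^{c Σ_b f b}` (§2's output shape, `c = μθ/(1−θ)`) and per-piece
animal entropies `a_b(v) ≤ (Cλ)^v` (`T4InsertionProfile.card_animals_filter_le` × the per-cube price `λ`):
`Σ_f ρ^k · N f · ∏_b a_b(f b) ≤ q/(1−q) · (κρ)^k`, `q = e^c C λ ≤ ½` (`recordFibre_le`; kernel: `Finset.prod_univ_sum`
factorises the volume-vector sum `sum_volVectors_le`, one geometric series per piece); then over records with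
`#{r : m r = k} ≤ Γ₀^k` and `m r ≥ m₀`: `Σ_{s ∈ Sh} y s ≤ D · (Γ₀κρ)^{m₀}/(1 − Γ₀κρ)` (`compositeShapeSum_le`, fibrewise
over records ∘ `recordSum_le`) — `recordSum_le`'s slot activity with `Γ = Γ₀ · κ` and the λ-small prefactor
`D = q/(1−q)`, ready for `pow_eventCount_le_twoRate` / `slotBudget_le` UNCHANGED.
§4 THE RECORD COUNT AND ITS ONE CUTOFF-SENSITIVE INPUT.  Event times with gaps in `[1, N′]` are `N′^k` gap vectors
(`card_gapRecords`) — the factor `N′` per event inside `Γ₀` (with the merger-tree shape `≤ 4` per event,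
`T4InsertionProfile.card_mergerTrees_le`, and a kind bit).  If the window `N′ = R_s` grows along the run (the B14 (2.9)
creep), the gap entropy is paid SCALE-LOCALLY by the same event's credit: `κ₁ R ≤ P ⇒ R · e^{−cP} ≤ (2e^{−1}/(cκ₁)) ·
e^{−cP/2}` (`gapEntropy_paired`, from Mathlib's `Real.mul_exp_neg_le_exp_neg_one`), the hypothesis `κ₁ R_s ≤ p₀(g_s)`
with a CUTOFF-UNIFORM `κ₁` being exactly `T4ScalePairing.kappa_mul_R_le_p0Profile` (U5c §9 pairing).
LOCATED CONSTANT REGIME (answer to the row's risk, objection G-pv02g7-3): the composite constants `Γ = Γ₀κ`,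
`C′ = e^{μθ/(1−θ)} C` (and `D`) contain NO function of the cutoff `K` or of the window length A(K): `θ, κ` are read from
p. 384 (current-scale cover: constant + shrunk birth size), `μ` from the locality of one step, `C` from the
lattice-animal theorem, and the only run-dependent input `N′ = R_s` is discharged per event by §4 at the cost of halving
the credit exponent.  Hence the LOG-window condition of `T4MatchingClosure` / `T4GoodClassBudget` (rate `Γρ` vs. window constant)
is NOT moved by the joint count; a factor of type `L^{4·A(K)}` could only arise from counting attachment sites in the
final lattice (θ ↦ Λ > 1), which the typed hypothesis of §2 excludes and p. 384 does not suggest.  Whether Bałaban's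
expansion satisfies the typed hypotheses (site bound in a frozen history, multiplicity, record count) is the cell's
E2-ent/E2-ins modelling, NOT decided here.

Sources.  [Balaban1989LargeFieldII] pp. 383–384 — CONTEXT / LOCATION ONLY as above.  Everything proved below is
elementary finite combinatorics and real analysis (Mathlib: `Finset.prod_one_add`, `Finset.prod_sum`,
`Finset.prod_univ_sum`, `Finset.card_pi`, `Fintype.card_piFinset_const`, `Real.mul_exp_neg_le_exp_neg_one`; tree:
`B13FamilySum.prod_one_add_le_exp_sum`, `T4WeightBudget.sum_pow_le_of_le`, `T4HistoryPeeling.recordSum_le`,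
`T4PeierlsDomination.sum_le_of_fibre_dom`). [folklore]
Unit `b2b-balaban-pv14` gen 7 (journal CLAIM T4-U5.E-a2-JOINT° 2026-08-19T01:25:41Z); imports `T4InsertionProfile`
(row T4-U5.E-a2*, this lineage gen 6) only.
-/

open Finset

namespace Literature.MathematicalPhysics.QuantumFieldTheory.Balaban1983to89.T4JointInsertionProfile

open B13FamilySum T4WeightBudget T4PeierlsDomination T4HistoryPeeling T4InsertionProfile

/-! ## §1 Across simultaneously pending slots: the joint profile is a product (no loss beyond the slot budget) -/

section AcrossSlots

/-- **JOINT ACTIVITY OVER ALL CHARGES = PRODUCT.**  `Σ_{Q ⊆ s} ∏_{i ∈ Q} x i = ∏_{i ∈ s} (1 + x i)`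
(Mathlib `Finset.prod_one_add`): summing the fibre bounds `∏_{i∈Q} x i` of `T4HistoryPeeling.SwitchOff.fibre_dom` over
all charges costs exactly the product — no multiplicity factor in the number of slots. [folklore] -/
theorem jointActivity_eq {α : Type*} (s : Finset α) (x : α → ℝ) :
    ∑ Q ∈ s.powerset, ∏ i ∈ Q, x i = ∏ i ∈ s, (1 + x i) :=
  (Finset.prod_one_add s).symm

/-- … and `∏ (1 + x i) ≤ exp(Σ x i)` for `x ≥ 0` (`B13FamilySum.prod_one_add_le_exp_sum`): the joint activity is
controlled by the slot budget `Σ_i x i ≤ S K` alone. [folklore] -/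
theorem jointActivity_le_exp {α : Type*} (s : Finset α) (x : α → ℝ) (hx : ∀ i ∈ s, 0 ≤ x i) :
    ∑ Q ∈ s.powerset, ∏ i ∈ Q, x i ≤ Real.exp (∑ i ∈ s, x i) := by
  rw [jointActivity_eq]
  exact prod_one_add_le_exp_sum s x hx

/-- **THE JOINT CATALOGUE IS THE DEPENDENT PRODUCT.**  For a charge `Q` and per-slot shape catalogues `Sh i`, the joint
insertion profiles form `Q.pi Sh`, of cardinality `∏_{i ∈ Q} #(Sh i)` (Mathlib `Finset.card_pi`): the simultaneous count
over all pending slots IS the product of the per-slot counts. [folklore] -/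
theorem card_jointCatalogue {α σ : Type*} [DecidableEq α] (Q : Finset α) (Sh : α → Finset σ) :
    (Q.pi Sh).card = ∏ i ∈ Q, (Sh i).card :=
  Finset.card_pi Q Sh

/-- **JOINT ENTROPY = PRODUCT OF SLOT ENTROPIES** (Mathlib `Finset.prod_sum`): the joint price sum over `Q.pi Sh` of the
product prices equals `∏_{i ∈ Q} Σ_{s ∈ Sh i} y i s`. [folklore] -/
theorem jointEntropy_eq_prod {α σ : Type*} [DecidableEq α] (Q : Finset α) (Sh : α → Finset σ) (y : α → σ → ℝ) :
    ∑ f ∈ Q.pi Sh, ∏ i ∈ Q.attach, y i.1 (f i.1 i.2) = ∏ i ∈ Q, ∑ s ∈ Sh i, y i s :=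
  (Finset.prod_sum Q Sh y).symm

/-- Hence under the per-slot entropy clause (ENT) `Σ_{s ∈ Sh i} y i s ≤ x i` (prices `≥ 0`) the joint entropy over the
charge `Q` is `≤ ∏_{i ∈ Q} x i` — the right-hand side of `fibre_dom`, with no further loss. [folklore] -/
theorem jointEntropy_le {α σ : Type*} [DecidableEq α] (Q : Finset α) (Sh : α → Finset σ) (y : α → σ → ℝ)
    (x : α → ℝ) (hy : ∀ i ∈ Q, ∀ s ∈ Sh i, 0 ≤ y i s) (hent : ∀ i ∈ Q, ∑ s ∈ Sh i, y i s ≤ x i) :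
    ∑ f ∈ Q.pi Sh, ∏ i ∈ Q.attach, y i.1 (f i.1 i.2) ≤ ∏ i ∈ Q, x i := by
  rw [jointEntropy_eq_prod]
  exact Finset.prod_le_prod (fun i hi => Finset.sum_nonneg (hy i hi)) hent

/-- **THE JOINT STATEMENT FOR A `PointDom`**, per `(K, t)`: the switch-off structure and activities of
`PointDom.toSlotDom`, the charge-wise fibre bound `Σ_{τ bad : erase τ = τ′, charge τ = Q} A ≤ A τ′ · ∏_{i∈Q} x i`
(`SwitchOff.fibre_dom`) and its resummation over ALL charges `Σ_{bad} A ≤ (∏_i (1 + x i) − 1) · Σ_{good} A`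
(`T4PeierlsDomination.sum_le_of_fibre_dom`).  Joint over all pending slots, the only factor is `∏_i (1 + x i) − 1`.
[folklore] -/
theorem PointDom.jointFibre {ι : Type*} [DecidableEq ι] {σ : Type*} {l₀ : ℝ} {T : ℕ → Finset ι}
    {A : ℕ → ℝ → ι → ℝ} {Bad : ℕ → ℝ → Finset ι} {S : ℕ → ℝ} (h : PointDom σ l₀ T A Bad S)
    (hA : ∀ K t, |t| ≤ l₀ → ∀ τ ∈ T K, 0 ≤ A K t τ) (K : ℕ) (t : ℝ) (ht : |t| ≤ l₀) :
    ∃ (n : ℕ) (Φ : SwitchOff (T K) n) (x : Fin n → ℝ), (∀ i, 0 ≤ x i) ∧ ∑ i, x i ≤ S K ∧ Bad K t = Φ.bad ∧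
      (∀ τ' ∈ T K \ Φ.bad, ∀ Q : Finset (Fin n),
        ∑ τ ∈ Φ.bad with (Φ.erase τ = τ' ∧ Φ.charge τ = Q), A K t τ ≤ A K t τ' * ∏ i ∈ Q, x i) ∧
      ∑ τ ∈ Φ.bad, A K t τ ≤ ((∏ i, (1 + x i)) - 1) * ∑ τ' ∈ T K \ Φ.bad, A K t τ' := by
  obtain ⟨n, Φ, x, hx, hxS, hBad, h1⟩ := (h.toSlotDom hA).dom K t ht
  have hfib := Φ.fibre_dom (hA K t ht) hx h1
  refine ⟨n, Φ, x, hx, hxS, hBad, hfib, ?_⟩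
  exact sum_le_of_fibre_dom Φ.bad (T K \ Φ.bad) Finset.univ (A K t) (A K t) x Φ.erase Φ.charge
    (fun τ hτ => Φ.erase_mem_sdiff (Φ.bad_subset hτ))
    (fun τ hτ => ⟨Finset.subset_univ _, Φ.charge_nonempty_of_mem_bad hτ⟩)
    (fun τ' hτ' Q _ => hfib τ' hτ' Q)

end AcrossSlots

/-! ## §2 Within one slot: the shrinking attachment entropy (typed; a constant per event × exponential in the volume) -/

section Shrinking

/-- Geometric series over later times: for a finite set of times `S` all `> t₀` and `0 ≤ θ < 1`,
`Σ_{t ∈ S} θ^{t − t₀} ≤ θ/(1 − θ)` (`T4WeightBudget.sum_pow_le_of_le` after the injective shift `t ↦ t − t₀`).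
[folklore] -/
theorem sum_pow_sub_le {θ : ℝ} (h0 : 0 ≤ θ) (h1 : θ < 1) (S : Finset ℕ) (t₀ : ℕ) (hS : ∀ t ∈ S, t₀ < t) :
    ∑ t ∈ S, θ ^ (t - t₀) ≤ θ / (1 - θ) := by
  have hinj : Set.InjOn (fun t => t - t₀) ↑S := by
    intro a ha b hb hab
    have h₁ := hS a ha
    have h₂ := hS b hb
    simp only at hab
    omega
  calc ∑ t ∈ S, θ ^ (t - t₀) = ∑ d ∈ S.image (fun t => t - t₀), θ ^ d := (Finset.sum_image hinj).symm
    _ ≤ θ ^ 1 / (1 - θ) :=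
        sum_pow_le_of_le h0 h1 fun d hd => by
          obtain ⟨t, ht, rfl⟩ := Finset.mem_image.1 hd
          have := hS t ht
          omega
    _ = θ / (1 - θ) := by rw [pow_one]

/-- **ONE PIECE, ALL LATER EVENTS TOUCHING IT.**  Events `E` with times `tE e > t₀` (the piece's birth), at most `μ`
of them at each time: `Σ_{e ∈ E} θ^{tE e − t₀} ≤ μ · θ/(1 − θ)` (fibrewise over the distinct times, then
`sum_pow_sub_le`). [folklore] -/
theorem eventSum_le {ε : Type*} {θ : ℝ} (h0 : 0 ≤ θ) (h1 : θ < 1) (E : Finset ε) (tE : ε → ℕ) (t₀ : ℕ) {μ : ℕ}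
    (hlt : ∀ e ∈ E, t₀ < tE e) (hμ : ∀ t : ℕ, (E.filter fun e => tE e = t).card ≤ μ) :
    ∑ e ∈ E, θ ^ (tE e - t₀) ≤ (μ : ℝ) * (θ / (1 - θ)) := by
  have hmaps : ∀ e ∈ E, tE e ∈ E.image tE := fun e he => Finset.mem_image_of_mem tE he
  calc ∑ e ∈ E, θ ^ (tE e - t₀) = ∑ t ∈ E.image tE, ∑ e ∈ E with tE e = t, θ ^ (tE e - t₀) :=
        (Finset.sum_fiberwise_of_maps_to hmaps _).symm
    _ = ∑ t ∈ E.image tE, ((E.filter fun e => tE e = t).card : ℝ) * θ ^ (t - t₀) :=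
        Finset.sum_congr rfl fun t _ => by
          have hc : ∀ e ∈ E.filter (fun e => tE e = t), θ ^ (tE e - t₀) = θ ^ (t - t₀) := fun e he => by
            rw [(Finset.mem_filter.1 he).2]
          rw [Finset.sum_congr rfl hc, Finset.sum_const, nsmul_eq_mul]
    _ ≤ ∑ t ∈ E.image tE, (μ : ℝ) * θ ^ (t - t₀) :=
        Finset.sum_le_sum fun t _ => mul_le_mul_of_nonneg_right (by exact_mod_cast hμ t) (pow_nonneg h0 _)
    _ = (μ : ℝ) * ∑ t ∈ E.image tE, θ ^ (t - t₀) := (Finset.mul_sum _ _ _).symm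
    _ ≤ (μ : ℝ) * (θ / (1 - θ)) :=
        mul_le_mul_of_nonneg_left
          (sum_pow_sub_le h0 h1 _ t₀ fun t ht => by
            obtain ⟨e, he, rfl⟩ := Finset.mem_image.1 ht
            exact hlt e he)
          (Nat.cast_nonneg μ)

/-- **THE SITE EXPONENT IS LINEAR IN THE TOTAL VOLUME.**  Pieces `B` (volumes `w ≥ 0`, birth times `tB`), events `E`
(times `tE`, piece sets `P e ⊆ B` of strictly older pieces), multiplicity `≤ μ` events touching a given piece per time:
`Σ_{e ∈ E} Σ_{b ∈ P e} w b · θ^{tE e − tB b} ≤ μθ/(1−θ) · Σ_{b ∈ B} w b` (swap the sums onto pieces, `eventSum_le` per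
piece). [folklore] -/
theorem siteExponent_le {ε β : Type*} [DecidableEq β] {θ : ℝ} (h0 : 0 ≤ θ) (h1 : θ < 1) (E : Finset ε)
    (B : Finset β) (tE : ε → ℕ) (tB : β → ℕ) (P : ε → Finset β) (w : β → ℝ) {μ : ℕ}
    (hPB : ∀ e ∈ E, P e ⊆ B) (hw : ∀ b ∈ B, 0 ≤ w b) (hlt : ∀ e ∈ E, ∀ b ∈ P e, tB b < tE e)
    (hμ : ∀ b ∈ B, ∀ t : ℕ, (E.filter fun e => b ∈ P e ∧ tE e = t).card ≤ μ) :
    ∑ e ∈ E, ∑ b ∈ P e, w b * θ ^ (tE e - tB b) ≤ (μ : ℝ) * (θ / (1 - θ)) * ∑ b ∈ B, w b := by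
  calc ∑ e ∈ E, ∑ b ∈ P e, w b * θ ^ (tE e - tB b)
        = ∑ e ∈ E, ∑ b ∈ B, (if b ∈ P e then w b * θ ^ (tE e - tB b) else 0) :=
          Finset.sum_congr rfl fun e he => by
            rw [← Finset.sum_filter]
            exact Finset.sum_congr
              (by
                ext b
                simp only [Finset.mem_filter]
                exact ⟨fun hb => ⟨hPB e he hb, hb⟩, fun hb => hb.2⟩)
              fun _ _ => rfl
    _ = ∑ b ∈ B, ∑ e ∈ E, (if b ∈ P e then w b * θ ^ (tE e - tB b) else 0) := Finset.sum_comm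
    _ = ∑ b ∈ B, w b * ∑ e ∈ E with b ∈ P e, θ ^ (tE e - tB b) :=
          Finset.sum_congr rfl fun b _ => by
            rw [Finset.sum_filter, Finset.mul_sum]
            exact Finset.sum_congr rfl fun e _ => by split_ifs <;> simp
    _ ≤ ∑ b ∈ B, w b * ((μ : ℝ) * (θ / (1 - θ))) :=
          Finset.sum_le_sum fun b hb =>
            mul_le_mul_of_nonneg_left
              (eventSum_le h0 h1 (E.filter fun e => b ∈ P e) tE (tB b)
                (fun e he => hlt e (Finset.mem_filter.1 he).1 b (Finset.mem_filter.1 he).2)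
                fun t => by rw [Finset.filter_filter]; exact hμ b hb t)
              (hw b hb)
    _ = (μ : ℝ) * (θ / (1 - θ)) * ∑ b ∈ B, w b := by
          rw [Finset.mul_sum]
          exact Finset.sum_congr rfl fun b _ => mul_comm _ _

/-- **SHRINKING ATTACHMENT ENTROPY (HYPOTHESIS SHAPE → PRODUCT BOUND; the site count itself is NOT PRINTED).**  With the
data of `siteExponent_le` and site factors `0 ≤ N e ≤ κ · (1 + Σ_{b ∈ P e} w b · θ^{tE e − tB b})` (READING of p. 384:
a later event touches an old region only inside the region's current-scale neighbourhood, of size a constant plus the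
shrunk birth size «d′_n(Z^{(n−j)}) ≤ 2^{−(n−j)}d′_j(Z)»): `∏_{e ∈ E} N e ≤ κ^{#E} · exp(μθ/(1−θ) · Σ_{b ∈ B} w b)` — a
constant per EVENT and an exponential in the TOTAL VOLUME, i.e. of the type `Γ^k · C^w` of
`T4InsertionProfile.gradedShapeSum_le`. [folklore] -/
theorem prod_sites_le_exp {ε β : Type*} [DecidableEq β] {θ κ : ℝ} (h0 : 0 ≤ θ) (h1 : θ < 1) (hκ : 0 ≤ κ)
    (E : Finset ε) (B : Finset β) (tE : ε → ℕ) (tB : β → ℕ) (P : ε → Finset β) (w : β → ℝ) (N : ε → ℝ) {μ : ℕ}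
    (hPB : ∀ e ∈ E, P e ⊆ B) (hw : ∀ b ∈ B, 0 ≤ w b) (hlt : ∀ e ∈ E, ∀ b ∈ P e, tB b < tE e)
    (hμ : ∀ b ∈ B, ∀ t : ℕ, (E.filter fun e => b ∈ P e ∧ tE e = t).card ≤ μ)
    (hN0 : ∀ e ∈ E, 0 ≤ N e) (hN : ∀ e ∈ E, N e ≤ κ * (1 + ∑ b ∈ P e, w b * θ ^ (tE e - tB b))) :
    ∏ e ∈ E, N e ≤ κ ^ E.card * Real.exp ((μ : ℝ) * (θ / (1 - θ)) * ∑ b ∈ B, w b) := by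
  have hx0 : ∀ e ∈ E, 0 ≤ ∑ b ∈ P e, w b * θ ^ (tE e - tB b) := fun e he =>
    Finset.sum_nonneg fun b hb => mul_nonneg (hw b (hPB e he hb)) (pow_nonneg h0 _)
  calc ∏ e ∈ E, N e ≤ ∏ e ∈ E, κ * (1 + ∑ b ∈ P e, w b * θ ^ (tE e - tB b)) := Finset.prod_le_prod hN0 hN
    _ = κ ^ E.card * ∏ e ∈ E, (1 + ∑ b ∈ P e, w b * θ ^ (tE e - tB b)) := by
        rw [Finset.prod_mul_distrib, Finset.prod_const]
    _ ≤ κ ^ E.card * Real.exp (∑ e ∈ E, ∑ b ∈ P e, w b * θ ^ (tE e - tB b)) :=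
        mul_le_mul_of_nonneg_left
          (prod_one_add_le_exp_sum E (fun e => ∑ b ∈ P e, w b * θ ^ (tE e - tB b)) hx0) (pow_nonneg hκ _)
    _ ≤ κ ^ E.card * Real.exp ((μ : ℝ) * (θ / (1 - θ)) * ∑ b ∈ B, w b) :=
        mul_le_mul_of_nonneg_left (Real.exp_le_exp.2 (siteExponent_le h0 h1 E B tE tB P w hPB hw hlt hμ))
          (pow_nonneg hκ _)

end Shrinking

/-! ## §3 Within one slot: the composite entropy (events × pieces × volumes × sites) in `recordSum_le`'s shape -/

section Composite

/-- The volume-vector sum factorises (Mathlib `Finset.prod_univ_sum`): for `p` pieces with volumes in `Wv ⊆ ℕ_{≥1}` and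
a summand dominated by `a · ∏_b q^{f b}`, `0 ≤ q < 1`: `Σ_{f ∈ Wv^p} F f ≤ a · (q/(1−q))^p`. [folklore] -/
theorem sum_volVectors_le (p : ℕ) (Wv : Finset ℕ) (hW : ∀ v ∈ Wv, 1 ≤ v) {q a : ℝ} (hq0 : 0 ≤ q) (hq1 : q < 1)
    (ha : 0 ≤ a) (F : (Fin p → ℕ) → ℝ)
    (hF : ∀ f ∈ Fintype.piFinset (fun _ : Fin p => Wv), F f ≤ a * ∏ b, q ^ f b) :
    ∑ f ∈ Fintype.piFinset (fun _ : Fin p => Wv), F f ≤ a * (q / (1 - q)) ^ p := by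
  calc ∑ f ∈ Fintype.piFinset (fun _ : Fin p => Wv), F f
        ≤ ∑ f ∈ Fintype.piFinset (fun _ : Fin p => Wv), a * ∏ b, q ^ f b := Finset.sum_le_sum hF
    _ = a * ∏ _b : Fin p, ∑ v ∈ Wv, q ^ v := by
        rw [← Finset.mul_sum, Finset.prod_univ_sum]
    _ ≤ a * ∏ _b : Fin p, (q / (1 - q)) :=
        mul_le_mul_of_nonneg_left
          (Finset.prod_le_prod (fun _ _ => Finset.sum_nonneg fun v _ => pow_nonneg hq0 v) fun _ _ =>
            (sum_pow_le_of_le hq0 hq1 hW).trans (le_of_eq (by rw [pow_one])))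
          ha
    _ = a * (q / (1 - q)) ^ p := by rw [Finset.prod_const, Finset.card_univ, Fintype.card_fin]

/-- `exp(c · Σ_b f b) = ∏_b (e^c)^{f b}` for a volume vector. [folklore] -/
theorem exp_mul_sum_eq_prod_pow {p : ℕ} (c : ℝ) (f : Fin p → ℕ) :
    Real.exp (c * ∑ b, (f b : ℝ)) = ∏ b, Real.exp c ^ f b := by
  rw [Finset.mul_sum, Real.exp_sum]
  exact Finset.prod_congr rfl fun b _ => by rw [mul_comm, Real.exp_nat_mul]

/-- **ONE RECORD'S FIBRE** (E2-ins reading: the shapes of one slot with a given record — `k` events, `p ≥ 1` pieces —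
are encoded by a volume vector `f ∈ Wv^p`, attachment sites and one anchored animal per piece; prices multiply: `ρ` per
event, `λ` per cube).  With site products `0 ≤ N f ≤ κ^k · e^{c Σ_b f b}` (the output shape of `prod_sites_le_exp`,
`c = μθ/(1−θ)`) and per-piece animal entropies `0 ≤ a_b(v) ≤ (Cλ)^v` (`card_animals_filter_le` × `λ^v`), and
`q := e^c · C · λ ≤ ½`:  `Σ_{f ∈ Wv^p} ρ^k · N f · ∏_b a_b(f b) ≤ q/(1−q) · (κρ)^k`.  The constant per event became
`κρ`; the volume was summed out into the λ-small prefactor `q/(1−q) ≤ 1` (one geometric series per piece, and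
`(q/(1−q))^p ≤ q/(1−q)`). [folklore] -/
theorem recordFibre_le (p k : ℕ) (hp : 1 ≤ p) (Wv : Finset ℕ) (hW : ∀ v ∈ Wv, 1 ≤ v) {ρ κ c C lam : ℝ}
    (hρ : 0 ≤ ρ) (hκ : 0 ≤ κ) (hC : 0 ≤ C) (hlam : 0 ≤ lam) (hq : Real.exp c * C * lam ≤ 1 / 2)
    (N : (Fin p → ℕ) → ℝ) (a : Fin p → ℕ → ℝ)
    (hN : ∀ f ∈ Fintype.piFinset (fun _ : Fin p => Wv), N f ≤ κ ^ k * Real.exp (c * ∑ b, (f b : ℝ)))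
    (ha0 : ∀ b v, 0 ≤ a b v) (ha : ∀ b, ∀ v ∈ Wv, a b v ≤ (C * lam) ^ v) :
    ∑ f ∈ Fintype.piFinset (fun _ : Fin p => Wv), ρ ^ k * N f * ∏ b, a b (f b) ≤
      Real.exp c * C * lam / (1 - Real.exp c * C * lam) * (κ * ρ) ^ k := by
  have hq0 : 0 ≤ Real.exp c * C * lam := mul_nonneg (mul_nonneg (Real.exp_pos c).le hC) hlam
  have hq1 : Real.exp c * C * lam < 1 := by linarith
  have hqq : Real.exp c * C * lam / (1 - Real.exp c * C * lam) ≤ 1 := by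
    rw [div_le_one (by linarith)]
    linarith
  have hstep : ∀ f ∈ Fintype.piFinset (fun _ : Fin p => Wv),
      ρ ^ k * N f * ∏ b, a b (f b) ≤ (κ * ρ) ^ k * ∏ b, (Real.exp c * C * lam) ^ f b := by
    intro f hf
    have hfb : ∀ b, f b ∈ Wv := fun b => Fintype.mem_piFinset.1 hf b
    have h2 : ∏ b, a b (f b) ≤ ∏ b, (C * lam) ^ f b :=
      Finset.prod_le_prod (fun b _ => ha0 b _) fun b _ => ha b _ (hfb b)
    calc ρ ^ k * N f * ∏ b, a b (f b)
          ≤ ρ ^ k * (κ ^ k * Real.exp (c * ∑ b, (f b : ℝ))) * ∏ b, (C * lam) ^ f b :=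
            mul_le_mul (mul_le_mul_of_nonneg_left (hN f hf) (pow_nonneg hρ k)) h2
              (Finset.prod_nonneg fun b _ => ha0 b _)
              (mul_nonneg (pow_nonneg hρ k) (mul_nonneg (pow_nonneg hκ k) (Real.exp_pos _).le))
      _ = (κ * ρ) ^ k * ((∏ b, Real.exp c ^ f b) * ∏ b, (C * lam) ^ f b) := by
            rw [exp_mul_sum_eq_prod_pow, mul_pow]
            ring
      _ = (κ * ρ) ^ k * ∏ b, (Real.exp c * C * lam) ^ f b := by
            rw [← Finset.prod_mul_distrib]
            exact congrArg _ (Finset.prod_congr rfl fun b _ => by rw [← mul_pow, ← mul_assoc])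
  calc ∑ f ∈ Fintype.piFinset (fun _ : Fin p => Wv), ρ ^ k * N f * ∏ b, a b (f b)
        ≤ (κ * ρ) ^ k * (Real.exp c * C * lam / (1 - Real.exp c * C * lam)) ^ p :=
          sum_volVectors_le p Wv hW hq0 hq1 (pow_nonneg (mul_nonneg hκ hρ) k) _ hstep
    _ ≤ (κ * ρ) ^ k * (Real.exp c * C * lam / (1 - Real.exp c * C * lam)) :=
          mul_le_mul_of_nonneg_left (pow_le_of_le_one (div_nonneg hq0 (by linarith)) hqq (by omega))
            (pow_nonneg (mul_nonneg hκ hρ) k)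
    _ = Real.exp c * C * lam / (1 - Real.exp c * C * lam) * (κ * ρ) ^ k := mul_comm _ _

/-- **COMPOSITE SHAPE SUM OF ONE SLOT** (the joint count over a structure's whole pending life, in the weighted form
that feeds `T4HistoryPeeling.recordSum_le`).  Shapes `Sh` fibred over records `Rec` by `rec`, per record an event count
`m r ≥ m₀` (R2), per-record fibre sums `≤ D · (κρ)^{m r}` (`recordFibre_le`: `D = q/(1−q)`), at most `Γ₀^k` records
with `k` events (gap vectors × merger trees × kinds, §4), `Γ₀κρ < 1` ⇒
`Σ_{s ∈ Sh} y s ≤ D · (Γ₀κρ)^{m₀}/(1 − Γ₀κρ)` — `recordSum_le`'s slot activity with `Γ = Γ₀ · κ` times a λ-small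
prefactor; `pow_eventCount_le_twoRate` / `slotBudget_le` apply UNCHANGED.  No constant here depends on the cutoff. [folklore] -/
theorem compositeShapeSum_le {S R : Type*} [DecidableEq R] (Sh : Finset S) (Rec : Finset R) (rec : S → R)
    (hrec : ∀ s ∈ Sh, rec s ∈ Rec) (m : R → ℕ) (y : S → ℝ) {ρ κ Γ₀ D : ℝ} (hρ : 0 ≤ ρ) (hκ : 0 ≤ κ)
    (hΓ : 0 ≤ Γ₀) (hD : 0 ≤ D) (hr : Γ₀ * (κ * ρ) < 1) {m₀ : ℕ}
    (hfibre : ∀ r ∈ Rec, ∑ s ∈ Sh with rec s = r, y s ≤ D * (κ * ρ) ^ m r)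
    (hcount : ∀ k, ((Rec.filter fun r => m r = k).card : ℝ) ≤ Γ₀ ^ k) (hm : ∀ r ∈ Rec, m₀ ≤ m r) :
    ∑ s ∈ Sh, y s ≤ D * ((Γ₀ * (κ * ρ)) ^ m₀ / (1 - Γ₀ * (κ * ρ))) := by
  calc ∑ s ∈ Sh, y s = ∑ r ∈ Rec, ∑ s ∈ Sh with rec s = r, y s :=
        (Finset.sum_fiberwise_of_maps_to hrec y).symm
    _ ≤ ∑ r ∈ Rec, D * (κ * ρ) ^ m r := Finset.sum_le_sum hfibre
    _ = D * ∑ r ∈ Rec, (κ * ρ) ^ m r := (Finset.mul_sum _ _ _).symm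
    _ ≤ D * ((Γ₀ * (κ * ρ)) ^ m₀ / (1 - Γ₀ * (κ * ρ))) :=
        mul_le_mul_of_nonneg_left
          (recordSum_le Rec m (fun r => (κ * ρ) ^ m r) (mul_nonneg hκ hρ) hΓ hr (fun _ _ => le_rfl) hcount hm) hD

end Composite

/-! ## §4 The record count: gap vectors, and the scale-local pairing of the one cutoff-sensitive input -/

section Records

/-- **EVENT TIMES WITH GAPS IN `[1, N′]` ARE `N′^k` GAP VECTORS** (Mathlib `Fintype.card_piFinset_const`): the factor
`N′` per event inside the record constant `Γ₀` (R2: consecutive events of a pending structure are `≤ N′` steps apart,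
`T4WeightBudget.card_Icc_le_of_windows`; the merger-tree shape adds `≤ 4` per event, `T4InsertionProfile.card_mergerTrees_le`).
[folklore] -/
theorem card_gapRecords (k N' : ℕ) : (Fintype.piFinset fun _ : Fin k => Finset.Icc 1 N').card = N' ^ k := by
  rw [Fintype.card_piFinset_const, Nat.card_Icc, Nat.add_sub_cancel]

/-- `x · e^{−a x} ≤ e^{−1}/a` for `a > 0` (Mathlib `Real.mul_exp_neg_le_exp_neg_one`). [folklore] -/
theorem mul_exp_neg_mul_le {a : ℝ} (ha : 0 < a) (x : ℝ) : x * Real.exp (-(a * x)) ≤ Real.exp (-1) / a := by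
  rw [le_div_iff₀ ha]
  calc x * Real.exp (-(a * x)) * a = a * x * Real.exp (-(a * x)) := by ring
    _ ≤ Real.exp (-1) := Real.mul_exp_neg_le_exp_neg_one (a * x)

/-- **THE GAP ENTROPY IS PAID SCALE-LOCALLY.**  If the window at an event's scale is dominated by the credit profile at
the SAME scale, `κ₁ · R ≤ P` with a cutoff-uniform `κ₁ > 0` (hypothesis shape = the conclusion of
`T4ScalePairing.kappa_mul_R_le_p0Profile`, U5c §9), then the `R` gap choices of that event times its credit `e^{−cP}`
are at most `(2e^{−1}/(cκ₁)) · e^{−cP/2}`: a cutoff-free constant per event and half the credit exponent kept.  So a window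
`N′ = R_s` growing along the run does NOT make `Γ₀` cutoff-dependent. [folklore] -/
theorem gapEntropy_paired {R P c κ₁ : ℝ} (hR : 0 ≤ R) (hc : 0 < c) (hκ : 0 < κ₁) (hpair : κ₁ * R ≤ P) :
    R * Real.exp (-(c * P)) ≤ 2 * Real.exp (-1) / (c * κ₁) * Real.exp (-(c * P / 2)) := by
  have hc' : c ≠ 0 := hc.ne'
  have hκ' : κ₁ ≠ 0 := hκ.ne'
  have h1 : Real.exp (-(c * P)) = Real.exp (-(c * P / 2)) * Real.exp (-(c * P / 2)) := by
    rw [← Real.exp_add]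
    congr 1
    ring
  have hcP : c * (κ₁ * R) ≤ c * P := mul_le_mul_of_nonneg_left hpair hc.le
  have h2 : Real.exp (-(c * P / 2)) ≤ Real.exp (-(c * κ₁ / 2 * R)) := Real.exp_le_exp.2 (by linarith)
  have h3 : R * Real.exp (-(c * κ₁ / 2 * R)) ≤ Real.exp (-1) / (c * κ₁ / 2) :=
    mul_exp_neg_mul_le (by positivity) R
  calc R * Real.exp (-(c * P)) = R * Real.exp (-(c * P / 2)) * Real.exp (-(c * P / 2)) := by rw [h1]; ring
    _ ≤ R * Real.exp (-(c * κ₁ / 2 * R)) * Real.exp (-(c * P / 2)) :=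
        mul_le_mul_of_nonneg_right (mul_le_mul_of_nonneg_left h2 hR) (Real.exp_pos _).le
    _ ≤ Real.exp (-1) / (c * κ₁ / 2) * Real.exp (-(c * P / 2)) :=
        mul_le_mul_of_nonneg_right h3 (Real.exp_pos _).le
    _ = 2 * Real.exp (-1) / (c * κ₁) * Real.exp (-(c * P / 2)) := by
        congr 1
        field_simp

end Records

/-! ## §5 Sanity -/

/-- Two events with gaps in `[1, 3]`: nine records. -/
example : (Fintype.piFinset fun _ : Fin 2 => Finset.Icc 1 3).card = 3 ^ 2 := card_gapRecords 2 3

/-- The shrinking rate read from «2^{−(n−j)}»: `θ = ½` gives `θ/(1−θ) = 1`, i.e. site exponent `μ · Σ_b w_b`. -/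
example : ((1 : ℝ) / 2) / (1 - 1 / 2) = 1 := by norm_num

/-- No events: the site product is `1 ≤ κ^0 · e^{…}` — `prod_sites_le_exp` on the empty event set. -/
example (κ : ℝ) (hκ : 0 ≤ κ) (B : Finset ℕ) (w : ℕ → ℝ) (hw : ∀ b ∈ B, 0 ≤ w b) :
    ∏ e ∈ (∅ : Finset ℕ), (fun _ => (5 : ℝ)) e ≤
      κ ^ (∅ : Finset ℕ).card * Real.exp (((1 : ℕ) : ℝ) * (((1 : ℝ) / 2) / (1 - 1 / 2)) * ∑ b ∈ B, w b) :=
  prod_sites_le_exp (θ := 1 / 2) (by norm_num) (by norm_num) hκ ∅ B (fun _ => 0) (fun _ => 0) (fun _ => ∅) w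
    (fun _ => 5) (μ := 1) (by simp) hw (by simp) (by simp) (by simp) (by simp)

end Literature.MathematicalPhysics.QuantumFieldTheory.Balaban1983to89.T4JointInsertionProfile
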